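import Mathlib
import Literature.Combinatorics.Additive.TripleProductProperty
import Literature.Computability.Complexity.CNFRelabel
import Summits.MatrixMultiplication.MatrixMultiplication.Theorems.HyperoctahedralThreshold.Negative.HostedTPPSAT

/-!
# Completeness of the hosted-TPP certificate CNF and the transfer `UNSAT ⇒ volume ≤ V`

Proofs for `HostedTPPSAT.lean` (definitions there): the canonical assignment of an index triple
satisfies every clause family of `HostData.rawCNF` (`…_hold`), hence
`HostData.certCNF_satisfiable_of_triple`; pair packing inside the hosts from the TPP
(`HostData.card_mul_card_le_pairCount`, Cohn–Umans 2003, proof of Lemma 3.1); and the transfer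
theorem `HostData.volume_le_of_unsat`: an UNSAT certificate for `certCNF D (pairBounds D) V`
bounds the volume of every hosted TPP triple containing the identities by `V`.

References: H. Cohn, C. Umans, FOCS 2003, Def. 2.1 and Lemma 3.1; C. Sinz, CP 2005, §2.
-/

namespace Summit.MatrixMultiplication.MatrixMultiplication.Theorems.HyperoctahedralThreshold.Negative

set_option linter.dupNamespace false

open Literature.Computability.Complexity Literature.Combinatorics.Additive

namespace HostData

variable {G : Type*} [Group G] [DecidableEq G] {N : ℕ} (D : HostData G N)

/-! ## Counting lemmas -/

/-- No element lies among the first `0` indices. [folklore] -/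
theorem cnt_zero (I : Finset (Fin N)) : cnt I 0 = 0 := by
  simp [cnt]

/-- One-step recurrence of the prefix count. [folklore] -/
theorem cnt_succ (I : Finset (Fin N)) (t : Fin N) :
    cnt I (t.val + 1) = cnt I t.val + (if t ∈ I then 1 else 0) := by
  unfold cnt
  have : I.filter (fun a => a.val < t.val + 1) =
      I.filter (fun a => a.val < t.val) ∪ I.filter (fun a => a = t) := by
    ext a; simp only [Finset.mem_filter, Finset.mem_union]
    constructor
    · rintro ⟨ha, hlt⟩
      rcases Nat.lt_succ_iff_lt_or_eq.1 hlt with h | h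
      · exact Or.inl ⟨ha, h⟩
      · exact Or.inr ⟨ha, Fin.ext h⟩
    · rintro (⟨ha, h⟩ | ⟨ha, rfl⟩)
      · exact ⟨ha, Nat.lt_succ_of_lt h⟩
      · exact ⟨ha, Nat.lt_succ_self _⟩
  rw [this, Finset.card_union_of_disjoint]
  · congr 1
    split_ifs with ht
    · rw [Finset.card_eq_one]; exact ⟨t, by ext a; simp; rintro rfl; exact ht⟩
    · rw [Finset.card_eq_zero]; ext a; simp; rintro ha rfl; exact ht ha
  · rw [Finset.disjoint_filter]; rintro a - hlt rfl; exact lt_irrefl _ hlt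

/-- The full prefix count is the cardinality. [folklore] -/
theorem cnt_N (I : Finset (Fin N)) : cnt I N = I.card := by
  unfold cnt; congr 1; exact Finset.filter_true_of_mem fun a _ => a.isLt

/-- The prefix count is monotone. [folklore] -/
theorem cnt_mono (I : Finset (Fin N)) {s t : ℕ} (h : s ≤ t) : cnt I s ≤ cnt I t := by
  unfold cnt
  apply Finset.card_le_card
  intro a ha
  rw [Finset.mem_filter] at ha ⊢
  exact ⟨ha.1, lt_of_lt_of_le ha.2 h⟩

/-- The prefix count is at most the prefix length. [folklore] -/
theorem cnt_le (I : Finset (Fin N)) (t : ℕ) : cnt I t ≤ t := by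
  unfold cnt
  calc (I.filter fun a => a.val < t).card ≤ (Finset.univ.filter fun a : Fin N => a.val < t).card :=
        Finset.card_le_card (Finset.filter_subset_filter _ (Finset.subset_univ I))
    _ ≤ (Finset.range t).card := by
        refine Finset.card_le_card_of_injOn (fun a => a.val) (fun a ha => ?_) ?_
        · simp only [Finset.coe_filter, Finset.mem_univ, true_and, Set.mem_setOf_eq] at ha
          simpa using ha
        · intro a _ b _ h; exact Fin.ext h
    _ = t := Finset.card_range t

section completeness

variable {D}
variable (hinj : ∀ i, Function.Injective (D.E i)) (hone : ∀ i, D.E i (D.one i) = 1)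
variable {P : Fin 3 × Fin 3 → ℕ} {V : ℕ} {I : Fin 3 → Finset (Fin N)}

/-- A clause holds iff some literal is true (unfolding). [folklore] -/
theorem clause_eval_iff (σ : HVar N → Bool) (c : Clause (HVar N)) :
    Clause.eval σ c = true ↔ ∃ l ∈ c, Literal.eval σ l = true := by
  simp [Clause.eval, List.any_eq_true]

/-- Value of a positive literal. [folklore] -/
theorem eval_pos (σ : HVar N → Bool) (v : HVar N) :
    Literal.eval σ (pos N v) = true ↔ σ v = true := by simp [Literal.eval]

/-- Value of a negative literal. [folklore] -/
theorem eval_neg (σ : HVar N → Bool) (v : HVar N) :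
    Literal.eval σ (neg N v) = true ↔ σ v = false := by simp [Literal.eval]

include hinj hone in
/-- The defining clauses hold under the canonical assignment. [cite: CohnUmans2003, Def. 2.1] -/
theorem quotClauses_hold (h1 : ∀ i, D.one i ∈ I i) :
    ∀ c ∈ D.quotClauses, Clause.eval (D.assignment I) c = true := by
  intro c hc
  simp only [quotClauses, List.mem_flatMap, List.mem_finRange, true_and, List.mem_append,
    List.mem_cons, List.mem_filterMap] at hc
  obtain ⟨i, hc⟩ := hc
  rw [clause_eval_iff]
  rcases hc with (rfl | rfl | hnil) | ⟨a, b, hb⟩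
  · refine ⟨_, List.mem_singleton.2 rfl, ?_⟩
    rw [eval_pos]; simp only [assignment, decide_eq_true_eq, Qidx, Finset.mem_image₂]
    exact ⟨D.one i, h1 i, D.one i, h1 i, D.q_self hinj hone i _⟩
  · refine ⟨_, List.mem_singleton.2 rfl, ?_⟩
    rw [eval_pos]; simpa [assignment] using h1 i
  · simp at hnil
  · by_cases hab : a = b
    · rw [if_pos hab] at hb; simp at hb
    rw [if_neg hab] at hb
    simp only [Option.some.injEq] at hb
    subst hb
    by_cases ha : a ∈ I i
    · by_cases hb' : b ∈ I i
      · refine ⟨pos N (.p i (D.q i a b)), by simp, ?_⟩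
        rw [eval_pos]; simp only [assignment, decide_eq_true_eq, Qidx, Finset.mem_image₂]
        exact ⟨a, ha, b, hb', rfl⟩
      · refine ⟨neg N (.x i b), by simp, ?_⟩
        rw [eval_neg]; simpa [assignment] using hb'
    · refine ⟨neg N (.x i a), by simp, ?_⟩
      rw [eval_neg]; simpa [assignment] using ha

/-- The TPP clauses hold under the canonical assignment of an index-TPP triple.
[cite: CohnUmans2003, Def. 2.1] -/
theorem tppClauses_hold (htpp : D.IndexTPP I) :
    ∀ c ∈ D.tppClauses, Clause.eval (D.assignment I) c = true := by
  intro c hc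
  simp only [tppClauses, List.mem_map] at hc
  obtain ⟨t, ht, rfl⟩ := hc
  rw [clause_eval_iff]
  have h := htpp t ht
  by_cases h0 : t.1 ∈ D.Qidx 0 (I 0)
  · by_cases h1 : t.2.1 ∈ D.Qidx 1 (I 1)
    · have h2 : t.2.2 ∉ D.Qidx 2 (I 2) := fun h2 => h ⟨h0, h1, h2⟩
      refine ⟨neg N (.p 2 t.2.2), by simp, ?_⟩
      rw [eval_neg]; simpa [assignment] using h2
    · refine ⟨neg N (.p 1 t.2.1), by simp, ?_⟩
      rw [eval_neg]; simpa [assignment] using h1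
  · refine ⟨neg N (.p 0 t.1), by simp, ?_⟩
    rw [eval_neg]; simpa [assignment] using h0

/-- The counter clauses hold under the canonical assignment (a genuine count satisfies both
directions of the Sinz recurrences). [cite: Sinz2005, §2] -/
theorem counterClauses_hold :
    ∀ c ∈ counterClauses N, Clause.eval (D.assignment I) c = true := by
  intro c hc
  simp only [counterClauses, List.mem_flatMap, List.mem_finRange, true_and, List.mem_append,
    List.mem_map, List.mem_cons] at hc
  obtain ⟨i, hc⟩ := hc
  rw [clause_eval_iff]
  rcases hc with (⟨t, rfl⟩ | ⟨j, rfl⟩) | ⟨t, j, hc⟩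
  · refine ⟨_, List.mem_singleton.2 rfl, ?_⟩
    rw [eval_pos]; simp [assignment]
  · refine ⟨_, List.mem_singleton.2 rfl, ?_⟩
    rw [eval_neg]; simp [assignment, cnt_zero]
  · have hsucc := cnt_succ (I i) t
    have hts : (t.succ : Fin (N + 1)).val = t.val + 1 := rfl
    have htc : (t.castSucc : Fin (N + 1)).val = t.val := rfl
    have hjs : (j.succ : Fin (N + 1)).val = j.val + 1 := rfl
    have hjc : (j.castSucc : Fin (N + 1)).val = j.val := rfl
    rcases hc with rfl | rfl | rfl | rfl | hnil
    · -- monotone: ¬ r t j+1 ∨ r t+1 j+1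
      by_cases h : j.val + 1 ≤ cnt (I i) t.val
      · refine ⟨pos N (.r i t.succ j.succ), by simp, ?_⟩
        rw [eval_pos]; simp only [assignment, decide_eq_true_eq, hts, hjs, hsucc]; omega
      · refine ⟨neg N (.r i t.castSucc j.succ), by simp, ?_⟩
        rw [eval_neg]; simp only [assignment, decide_eq_false_iff_not, htc, hjs]; exact h
    · -- count up: ¬ x t ∨ ¬ r t j ∨ r t+1 j+1
      by_cases hx : t ∈ I i
      · by_cases h : j.val ≤ cnt (I i) t.val
        · refine ⟨pos N (.r i t.succ j.succ), by simp, ?_⟩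
          rw [eval_pos]; simp only [assignment, decide_eq_true_eq, hts, hjs, hsucc, if_pos hx]; omega
        · refine ⟨neg N (.r i t.castSucc j.castSucc), by simp, ?_⟩
          rw [eval_neg]; simp only [assignment, decide_eq_false_iff_not, htc, hjc]; exact h
      · refine ⟨neg N (.x i t), by simp, ?_⟩
        rw [eval_neg]; simpa [assignment] using hx
    · -- ¬ r t+1 j+1 ∨ r t j+1 ∨ x t
      by_cases hx : t ∈ I i
      · refine ⟨pos N (.x i t), by simp, ?_⟩
        rw [eval_pos]; simpa [assignment] using hx
      · by_cases h : j.val + 1 ≤ cnt (I i) (t.val + 1)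
        · refine ⟨pos N (.r i t.castSucc j.succ), by simp, ?_⟩
          rw [eval_pos]; simp only [assignment, decide_eq_true_eq, htc, hjs]
          rw [hsucc, if_neg hx] at h; simpa using h
        · refine ⟨neg N (.r i t.succ j.succ), by simp, ?_⟩
          rw [eval_neg]; simp only [assignment, decide_eq_false_iff_not, hts, hjs]; exact h
    · -- ¬ r t+1 j+1 ∨ r t j
      by_cases h : j.val + 1 ≤ cnt (I i) (t.val + 1)
      · refine ⟨pos N (.r i t.castSucc j.castSucc), by simp, ?_⟩
        rw [eval_pos]; simp only [assignment, decide_eq_true_eq, htc, hjc]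
        rw [hsucc] at h; split_ifs at h <;> omega
      · refine ⟨neg N (.r i t.succ j.succ), by simp, ?_⟩
        rw [eval_neg]; simp only [assignment, decide_eq_false_iff_not, hts, hjs]; exact h
    · simp at hnil

/-- The size bit semantics: `S i j` is true iff `j ≤ |I i|`. [folklore] -/
theorem assignment_S (i : Fin 3) (j : Fin (N + 1)) :
    D.assignment I (S i j) = decide (j.val ≤ (I i).card) := by
  simp [S, assignment, cnt_N]

/-- The pair-packing clauses hold when the pair bounds hold. [cite: CohnUmans2003, Lemma 3.1] -/
theorem ppClauses_hold (hpp : ∀ ij ∈ pairs, (I ij.1).card * (I ij.2).card ≤ P ij) :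
    ∀ c ∈ ppClauses N P, Clause.eval (D.assignment I) c = true := by
  intro c hc
  simp only [ppClauses, List.mem_flatMap, List.mem_append, List.mem_filterMap, List.mem_finRange,
    true_and] at hc
  obtain ⟨ij, hij, hc⟩ := hc
  have hP := hpp ij hij
  rw [clause_eval_iff]
  rcases hc with ⟨a, ha⟩ | ⟨b, hb⟩
  · by_cases hlt : P ij / (a.val + 1) + 1 < N + 1
    · rw [dif_pos hlt] at ha
      simp only [Option.some.injEq] at ha; subst ha
      by_cases h1 : a.val + 1 ≤ (I ij.1).card
      · refine ⟨_, List.mem_cons_of_mem _ (List.mem_singleton.2 rfl), ?_⟩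
        rw [eval_neg, assignment_S]; simp only [decide_eq_false_iff_not, not_le]
        -- |I j| ≤ P/(a+1) < P/(a+1)+1
        have : (I ij.2).card ≤ P ij / (a.val + 1) := by
          rw [Nat.le_div_iff_mul_le (Nat.succ_pos _)]
          calc (I ij.2).card * (a.val + 1) ≤ (I ij.2).card * (I ij.1).card :=
                Nat.mul_le_mul_left _ h1
            _ = (I ij.1).card * (I ij.2).card := Nat.mul_comm _ _
            _ ≤ P ij := hP
        omega
      · refine ⟨_, List.mem_cons_self, ?_⟩
        rw [eval_neg, assignment_S]; simpa using h1
    · rw [dif_neg hlt] at ha; simp at ha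
  · by_cases hlt : P ij / (b.val + 1) + 1 < N + 1
    · rw [dif_pos hlt] at hb
      simp only [Option.some.injEq] at hb; subst hb
      by_cases h1 : b.val + 1 ≤ (I ij.2).card
      · refine ⟨_, List.mem_cons_of_mem _ (List.mem_singleton.2 rfl), ?_⟩
        rw [eval_neg, assignment_S]; simp only [decide_eq_false_iff_not, not_le]
        have : (I ij.1).card ≤ P ij / (b.val + 1) := by
          rw [Nat.le_div_iff_mul_le (Nat.succ_pos _)]
          calc (I ij.1).card * (b.val + 1) ≤ (I ij.1).card * (I ij.2).card :=
                Nat.mul_le_mul_left _ h1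
            _ ≤ P ij := hP
        omega
      · refine ⟨_, List.mem_cons_self, ?_⟩
        rw [eval_neg, assignment_S]; simpa using h1
    · rw [dif_neg hlt] at hb; simp at hb

/-- The volume clauses hold for a triple of volume `> V` (the selector of the exact sizes of the
first two sets is on, all others off). [folklore] -/
theorem volClauses_hold (h0 : 0 < (I 0).card) (h1 : 0 < (I 1).card) (h2 : (I 2).card ≤ N)
    (hvol : V < (I 0).card * (I 1).card * (I 2).card) :
    ∀ c ∈ volClauses N V, Clause.eval (D.assignment I) c = true := by
  -- the selected pair
  have hA : (I 0).card - 1 < N := by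
    have := Finset.card_le_univ (I 0); simp only [Fintype.card_fin] at this; omega
  have hB : (I 1).card - 1 < N := by
    have := Finset.card_le_univ (I 1); simp only [Fintype.card_fin] at this; omega
  obtain ⟨a₀, ha1⟩ : ∃ a₀ : Fin N, a₀.val + 1 = (I 0).card :=
    ⟨⟨(I 0).card - 1, hA⟩, by show (I 0).card - 1 + 1 = _; omega⟩
  obtain ⟨b₀, hb1⟩ : ∃ b₀ : Fin N, b₀.val + 1 = (I 1).card :=
    ⟨⟨(I 1).card - 1, hB⟩, by show (I 1).card - 1 + 1 = _; omega⟩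
  have hthird : third V a₀ b₀ ≤ (I 2).card := by
    unfold third; rw [ha1, hb1]
    have hpos : 0 < (I 0).card * (I 1).card := Nat.mul_pos h0 h1
    have : V / ((I 0).card * (I 1).card) < (I 2).card := by
      rw [Nat.div_lt_iff_lt_mul hpos]; linarith [Nat.mul_comm ((I 0).card * (I 1).card) (I 2).card]
    omega
  have hsel : ∀ a b : Fin N, D.assignment I (.g a b) = true ↔ a = a₀ ∧ b = b₀ := by
    intro a b
    simp only [assignment, decide_eq_true_eq]
    constructor
    · rintro ⟨ha, hb⟩
      exact ⟨Fin.ext (by omega), Fin.ext (by omega)⟩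
    · rintro ⟨rfl, rfl⟩; exact ⟨ha1, hb1⟩
  intro c hc
  simp only [volClauses, List.mem_append, List.mem_flatMap, List.mem_finRange, true_and,
    List.mem_singleton] at hc
  rw [clause_eval_iff]
  rcases hc with ⟨a, b, hc⟩ | rfl
  · by_cases hg : D.assignment I (.g a b) = true
    · obtain ⟨rfl, rfl⟩ := (hsel a b).1 hg
      have hfit : third V a b < N + 1 := by omega
      rw [dif_pos hfit] at hc
      simp only [List.mem_cons, List.not_mem_nil, or_false] at hc
      rcases hc with rfl | rfl | rfl
      · refine ⟨_, List.mem_cons_of_mem _ (List.mem_singleton.2 rfl), ?_⟩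
        rw [eval_pos, assignment_S]; simp only [decide_eq_true_eq, Fin.val_succ]; omega
      · refine ⟨_, List.mem_cons_of_mem _ (List.mem_singleton.2 rfl), ?_⟩
        rw [eval_pos, assignment_S]; simp only [decide_eq_true_eq, Fin.val_succ]; omega
      · refine ⟨_, List.mem_cons_of_mem _ (List.mem_singleton.2 rfl), ?_⟩
        rw [eval_pos, assignment_S]; simpa using hthird
    · -- selector off: its negative literal is the head of every clause about it
      have hneg : Literal.eval (D.assignment I) (neg N (.g a b)) = true := by
        rw [eval_neg]; simpa using hg
      split_ifs at hc with hfit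
      · simp only [List.mem_cons, List.not_mem_nil, or_false] at hc
        rcases hc with rfl | rfl | rfl <;> exact ⟨_, List.mem_cons_self, hneg⟩
      · simp only [List.mem_singleton] at hc; subst hc
        exact ⟨_, List.mem_cons_self, hneg⟩
  · -- the big clause: the selected selector is present and true
    refine ⟨pos N (.g a₀ b₀), ?_, ?_⟩
    · simp only [List.mem_flatMap, List.mem_finRange, true_and, List.mem_filterMap]
      refine ⟨a₀, b₀, ?_⟩
      rw [if_pos (by omega)]
    · rw [eval_pos]; exact (hsel a₀ b₀).2 ⟨rfl, rfl⟩

include hinj hone in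
/-- **Completeness of the certificate CNF**: the canonical assignment of an index triple that
contains the identity indices, is index-TPP, respects the pair bounds `P` and has volume `> V`
satisfies `certCNF`. [cite: Sinz2005, §2] -/
theorem certCNF_satisfiable_of_triple (hI1 : ∀ i, D.one i ∈ I i) (htpp : D.IndexTPP I)
    (hpp : ∀ ij ∈ pairs, (I ij.1).card * (I ij.2).card ≤ P ij)
    (hvol : V < (I 0).card * (I 1).card * (I 2).card) : (D.certCNF P V).Satisfiable := by
  rw [certCNF, CNF.satisfiable_relabel_iff HVar.code_injective]
  refine ⟨D.assignment I, (CNF.eval_eq_true_iff _ _).2 fun c hc => ?_⟩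
  have h0 : 0 < (I 0).card := Finset.card_pos.2 ⟨_, hI1 0⟩
  have h1 : 0 < (I 1).card := Finset.card_pos.2 ⟨_, hI1 1⟩
  have h2 : (I 2).card ≤ N := by
    simpa only [Fintype.card_fin] using Finset.card_le_univ (I 2)
  simp only [rawCNF, List.mem_append] at hc
  rcases hc with (((hc | hc) | hc) | hc) | hc
  · exact quotClauses_hold hinj hone hI1 c hc
  · exact tppClauses_hold htpp c hc
  · exact counterClauses_hold c hc
  · exact ppClauses_hold hpp c hc
  · exact volClauses_hold h0 h1 h2 hvol c hc

end completeness

end HostData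

end Summit.MatrixMultiplication.MatrixMultiplication.Theorems.HyperoctahedralThreshold.Negative
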